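import Mathlib
import HarnessLib
import Summits.HubbardSuperconductivity.HubbardSuperconductivity.Theorems.KLProgrammeKLRegimeSplitSlotsV17F
import Summits.HubbardSuperconductivity.HubbardSuperconductivity.Theorems.KLProgrammeKLRegimeTwoLegReadJetDefs

/-!
# K3 gen-7-FLOW ((ρF-1), plan g16 KL STATUS 2026-08-27 l.2568): the V17F two-leg reading slot IS the parametric predicate at the package tables and
# the flow frame — `TwoLegReadJetsF L M G Q β U μ n ↔ TwoLegReadJetBound L M G.S Q.S' β U μ (klFlowFrameU L M β U μ n) n` (`Iff.rfl`)

Cell gate-hubbard-kl, seat p2 g10.  Bridge between `…SplitSlotsV17F` (p524744, §3 `TwoLegReadJetsF`) and `…TwoLegReadJetDefs` (p525183): stub 6-F concludes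
`TwoLegReadJetBound … (klC4aJetC) (klC4aJetC' P R) … (K_n) n`, and (M)/(e) reach the slot by `.mono` + the two package inequalities
(`twoLegReadJetsF_of_readJetBound_le`).  Proofs only (rfl-level); nothing about the model is asserted.
-/

noncomputable section

namespace Summit.HubbardSuperconductivity.HubbardSuperconductivity.Theorems.KLRegimeSplit

set_option linter.dupNamespace false -- summit = problem name (single-conjunct summit), D-0017

open Literature.MathematicalPhysics.QuantumLattice Literature.Probability.LatticeModels

variable {L M : ℕ} [NeZero L] [NeZero M] {G : GeoConsts} {Q : EngConsts} {β U μ : ℝ} {n : ℕ}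

variable (L M G Q β U μ n) in
/-- **The V17F reading slot is the parametric predicate at `(G.S, Q.S')` and the flow frame** (`Iff.rfl`). -/
theorem twoLegReadJetsF_iff :
    TwoLegReadJetsF L M G Q β U μ n ↔ TwoLegReadJetBound L M G.S Q.S' β U μ (klFlowFrameU L M β U μ n) n := Iff.rfl

/-- From the slot to the parametric form. -/
theorem TwoLegReadJetsF.readJetBound (h : TwoLegReadJetsF L M G Q β U μ n) :
    TwoLegReadJetBound L M G.S Q.S' β U μ (klFlowFrameU L M β U μ n) n := h

/-- From the parametric form at the package tables to the slot. -/
theorem TwoLegReadJetBound.twoLegReadJetsF (h : TwoLegReadJetBound L M G.S Q.S' β U μ (klFlowFrameU L M β U μ n) n) :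
    TwoLegReadJetsF L M G Q β U μ n := h

/-- **Stub 6-F ⇒ the slot**: the parametric reading at tables `c ≤ G.S`, `c′ ≤ Q.S'` (e.g. c4a-1's `klC4aJetC`, `klC4aJetC' P R` under the two package
inequalities) gives `TwoLegReadJetsF` by monotonicity. -/
theorem twoLegReadJetsF_of_readJetBound_le {c c' : ℕ → ℝ} (hc : ∀ k, c k ≤ G.S k) (hc' : ∀ k, c' k ≤ Q.S' k)
    (h : TwoLegReadJetBound L M c c' β U μ (klFlowFrameU L M β U μ n) n) : TwoLegReadJetsF L M G Q β U μ n :=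
  h.mono hc hc'

/-- The reading-jet conjunct of the two-leg slot. -/
theorem TwoLegStepV17F.readJets {P : SplitConsts} {R : RenConsts} (h : TwoLegStepV17F L M G P Q R β U μ n) :
    TwoLegReadJetBound L M G.S Q.S' β U μ (klFlowFrameU L M β U μ n) n := h.1

/-- The slopes conjunct of the two-leg slot. -/
theorem TwoLegStepV17F.slopes {P : SplitConsts} {R : RenConsts} (h : TwoLegStepV17F L M G P Q R β U μ n) :
    TwoLegSlopes L M R β U μ (klFlowFrameU L M β U μ n) n := h.2.1

/-- **The VALUE of the cumulative reading from the slot** (`k = 0`): `|ν_n(K_n)(θ)| ≤ curveJetBar G.S Q.S' U 0 n` — what child 2F's (a)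
`RenormalisedAtF … K_n R n` fit reads (`R.cr·klE0 ≥ G.S 0 + Q.S' 0·U₀`). -/
theorem TwoLegReadJetsF.abs_localPart_le (h : TwoLegReadJetsF L M G Q β U μ n) (θ : ℝ) :
    |klLocalPart L M β U μ (klFlowFrameU L M β U μ n) n θ| ≤ curveJetBar G.S Q.S' U 0 n :=
  TwoLegReadJetBound.abs_le h θ

end Summit.HubbardSuperconductivity.HubbardSuperconductivity.Theorems.KLRegimeSplit

end
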